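import Summits.BirchSwinnertonDyer.BirchSwinnertonDyer.Theorems.PrintCf2RamifiedOffTYZSquareSilenceTwoRPQFive
import HarnessLib

/-!
# Crux `PrintCf2.RamifiedOffTYZOfFacts` (stmt-BirchSwinnertonDyer-20509), line `offtyz-v7`, LEAD cycle 13 (cruxlead-20509 g12):
# THE EVEN CELL WITH THREE PRIMES `≡ 3 (mod 4)` — `n = 2abc`, `a ≡ b ≡ c ≡ 3` or `≡ 7 (mod 8)`, `(−c/a) = (−2/a)`, `(−c/b) = (−2/b)`:
# every single Frobenius moves `i`, the PAIR `φ_aφ_b` is the top witness; SIGNED radical bookkeeping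

THEOREMS ONLY (no `def`, no named fact, no `sorry`), `--supports stmt-BirchSwinnertonDyer-20509` (item 23431 = C⁺, even three-prime sectors).

For `a ≡ b ≡ c (mod 8)`, `a ≡ 3 (mod 4)`, the divisors of `n = 2abc` that are `≡ 6 (mod 8)` are `2a, 2b, 2c` (free shape `2·prime`) and `n`; none is
`≡ 5 (mod 8)` (`ab, ac, bc ≡ 1`, `abc ≡ a`).  So only the TOP block needs a witness.  Every `φ_x` (`x ∈ {a, b, c}`) has `φ_x(i) = −i`; the pair
`g = φ_aφ_b` fixes `i`, fixes `√−2` (`(−2/a) = (−2/b)` as `a ≡ b (mod 8)`), fixes `√−c` iff `(−c/a)(−c/b) = 1`, and — tracking the SIGNS of `φ_b` on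
`√−2, √−c, √−a, √−(2c), √−(2ca)` down to its own radical `√−b` through `√−x·√−y = ±i·√−(xy)` with `φ_b(i) = −i` — fixes `√−b` exactly when
`(−c/a) = (−2/a)` and `(−c/b) = (−2/b)` (quadratic reciprocity for `a ≡ b ≡ 3 (mod 4)`: `(−b/a) = −(−a/b)`); the own radical `√−a` then comes from `√−n`
(toolkit p737408).  `g² ∈ Gal(ℍ′_n/H′_n)` and `g ∉ Gal(ℍ′_n/H_n)` is the pair witness of p736078 (third ramified prime `2`).  Reading of the condition:
for `a ≡ b ≡ c ≡ 3 (mod 8)` it says `(c/a) = (c/b) = −1`, for `≡ 7 (mod 8)` it says `(c/a) = (c/b) = +1` (LEAD enumeration `instruments/pair_top.py`: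
these are ALL `L_n(i)`-trivial Frobenius pairs on such `n`; no single one is).
* `apply_sqrtNeg_mul_smul`, `apply_sqrtNeg_smul_of_mul` (signed radical rules, any signs — subsume the four unsigned/negating rules of p732749/p736493);
* `divisors_two_abc`, `trivialOnL_pair_three_mod_four`, `two_dvd_scriptL_two_abc_of_valuePrinted`, ★ **`two_dvd_scriptL_two_abc_of_facts :
  (tyz_cmPointRingClassFrobeniusValueData ∧ thm11_parity_of_scriptL ∧ GZK) → ∀ n a b c, … → ∀ L, IsScriptL n L → 2 ∣ L`**.
Beyond-print theorem: YES (conditional on the three named facts).  BSD is not proved by any of this; no class is closed by this file.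

References: [cite: TianYuanZhang2017, Thm. 1.1, §1 (p0002 L101–L110), §3.1 (p0011 L1–L73), Prop. 3.2 (2), Thm. 3.5, Thm. 3.6 (2), Lemma 3.18, proof of
Lemma 3.21 (p0020 L27–L63)]; [cite: Cox2013, §1 (1.13)–(1.15), §5.C Lemma 5.19, (5.22), Thm. 5.23, Cor. 5.25, §9.A]; [cite: HeathBrown1994SelmerCongruentII,
§1, Appendix (Monsky)]; [cite: Stevenhagen1995RedeiMatrices, §2]; [cite: Darmon2004, Thm. 3.22].
-/

noncomputable section

open scoped Classical

open WeierstrassCurve WeierstrassCurve.Affine Finset Literature.NumberTheory.EllipticCurves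
  Literature.NumberTheory.EllipticCurves.TianYuanZhang2017
  Literature.NumberTheory.EllipticCurves.TianYuanZhang2017.W2
  Summit.BirchSwinnertonDyer.Rank1Residual.P2.GenusPeriodTransferLayer
  Summit.BirchSwinnertonDyer.Rank1Residual.P2
  Summit.BirchSwinnertonDyer.PrintCf2.MoverAssembly
  Summit.BirchSwinnertonDyer.PrintCf2.SquareSilenceEven
  Summit.BirchSwinnertonDyer.PrintCf2.SquareSilenceCoefficients
  Summit.BirchSwinnertonDyer.PrintCf2.FrobeniusPairWitness
  Summit.BirchSwinnertonDyer.PrintCf2.LowerHalfTwoPrimesEvenDisplays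
  Summit.BirchSwinnertonDyer.PrintCf2.SixPQ
  Summit.BirchSwinnertonDyer.PrintCf2.TwoRPQFive

set_option autoImplicit false

namespace Summit.BirchSwinnertonDyer.PrintCf2.TwoABC

variable {n : ℕ} (D : GenusPointData n)

/-! ## §1 Signed radical rules: `√−x·√−y = ±i·√−(xy)` under an automorphism with `φ(i) = ±i` -/

/-- **Signed product rule**: if `φ(i) = sᵢ·i`, `φ(√−a) = s₁·√−a`, `φ(√−b) = s₂·√−b` (`sᵢ = ±1`), then `φ(√−(ab)) = sᵢs₁s₂·√−(ab)`.
[cite: TianYuanZhang2017, §3.1 (p0011 L60–L66)] -/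
theorem apply_sqrtNeg_mul_smul {a b : ℕ} (ha : a ∈ n.divisors) (hb : b ∈ n.divisors) (hab : a * b ∈ n.divisors)
    {φ : D.H ≃ₐ[ℚ] D.H} {sᵢ s₁ s₂ : ℤ} (hsᵢ : sᵢ = 1 ∨ sᵢ = -1)
    (hφi : φ D.im = sᵢ • D.im) (hφa : φ (D.sqrtNeg a) = s₁ • D.sqrtNeg a) (hφb : φ (D.sqrtNeg b) = s₂ • D.sqrtNeg b) :
    φ (D.sqrtNeg (a * b)) = (sᵢ * s₁ * s₂) • D.sqrtNeg (a * b) := by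
  have h1 : φ (D.im * D.sqrtNeg (a * b)) = (s₁ : D.H) * s₂ * (D.im * D.sqrtNeg (a * b)) := by
    rcases eq_or_eq_neg_of_sq_eq_sq' (sqrtNeg_mul_sq D ha hb hab).symm with e | e
    · rw [e, map_mul, hφa, hφb, zsmul_eq_mul, zsmul_eq_mul]; ring
    · rw [e, map_neg, map_mul, hφa, hφb, zsmul_eq_mul, zsmul_eq_mul]; ring
  rw [map_mul, hφi, zsmul_eq_mul] at h1
  have hs : (sᵢ : D.H) * sᵢ = 1 := by rcases hsᵢ with rfl | rfl <;> norm_num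
  have h2 : D.im * (φ (D.sqrtNeg (a * b)) - (sᵢ : D.H) * s₁ * s₂ * D.sqrtNeg (a * b)) = 0 := by
    linear_combination (sᵢ : D.H) * h1 - D.im * φ (D.sqrtNeg (a * b)) * hs
  rw [zsmul_eq_mul]; push_cast
  exact eq_of_sub_eq_zero ((mul_eq_zero.mp h2).resolve_left D.im_ne_zero)

/-- **Signed quotient rule**: if `φ(i) = sᵢ·i`, `φ(√−a) = s₁·√−a` (`s₁ = ±1`), `φ(√−(ab)) = s₃·√−(ab)`, then `φ(√−b) = sᵢs₁s₃·√−b`.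
[cite: TianYuanZhang2017, §3.1 (p0011 L60–L66)] -/
theorem apply_sqrtNeg_smul_of_mul {a b : ℕ} (ha : a ∈ n.divisors) (hb : b ∈ n.divisors) (hab : a * b ∈ n.divisors)
    {φ : D.H ≃ₐ[ℚ] D.H} {sᵢ s₁ s₃ : ℤ} (hs₁ : s₁ = 1 ∨ s₁ = -1)
    (hφi : φ D.im = sᵢ • D.im) (hφa : φ (D.sqrtNeg a) = s₁ • D.sqrtNeg a)
    (hφab : φ (D.sqrtNeg (a * b)) = s₃ • D.sqrtNeg (a * b)) : φ (D.sqrtNeg b) = (sᵢ * s₁ * s₃) • D.sqrtNeg b := by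
  have h1 : φ (D.sqrtNeg a * D.sqrtNeg b) = (sᵢ : D.H) * s₃ * (D.sqrtNeg a * D.sqrtNeg b) := by
    rcases eq_or_eq_neg_of_sq_eq_sq' (sqrtNeg_mul_sq D ha hb hab).symm with e | e
    · rw [← e, map_mul, hφi, hφab, zsmul_eq_mul, zsmul_eq_mul]; ring
    · rw [show D.sqrtNeg a * D.sqrtNeg b = -(D.im * D.sqrtNeg (a * b)) by rw [e, neg_neg], map_neg, map_mul, hφi, hφab,
        zsmul_eq_mul, zsmul_eq_mul]; ring
  rw [map_mul, hφa, zsmul_eq_mul] at h1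
  have hs : (s₁ : D.H) * s₁ = 1 := by rcases hs₁ with rfl | rfl <;> norm_num
  have h2 : D.sqrtNeg a * (φ (D.sqrtNeg b) - (sᵢ : D.H) * s₁ * s₃ * D.sqrtNeg b) = 0 := by
    linear_combination (s₁ : D.H) * h1 - D.sqrtNeg a * φ (D.sqrtNeg b) * hs
  rw [zsmul_eq_mul]; push_cast
  exact eq_of_sub_eq_zero ((mul_eq_zero.mp h2).resolve_left (D.sqrtNeg_ne_zero ha))

/-! ## §2 Divisors of `2abc`, `a ≡ b ≡ c (mod 8)`, `a ≡ 3 (mod 4)` -/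

/-- **Residues of the divisors of `2abc`** (`a ≡ b ≡ c (mod 8)` primes `≡ 3 (mod 4)`): none is `≡ 5 (mod 8)`; a divisor `≡ 6 (mod 8)` is `2a, 2b, 2c` or
`2abc`. [cite: TianYuanZhang2017, §3.1 (p0011 L67–L70)] -/
theorem divisors_two_abc {a b c : ℕ} (ha : Nat.Prime a) (hb : Nat.Prime b) (hc : Nat.Prime c) (ha4 : a % 4 = 3) (hab8 : b % 8 = a % 8)
    (hac8 : c % 8 = a % 8) {d : ℕ} (hd : d ∣ 2 * a * b * c) :
    d % 8 ≠ 5 ∧ (d % 8 = 6 → d = 2 * a ∨ d = 2 * b ∨ d = 2 * c ∨ d = 2 * a * b * c) := by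
  have hd' : d ∣ 2 * (a * b * c) := by rw [show 2 * (a * b * c) = 2 * a * b * c by ring]; exact hd
  have hρ : a % 8 = 3 ∨ a % 8 = 7 := by omega
  have hab : (a * b) % 8 = 1 := by
    have h1 := Nat.mul_mod a b 8
    rcases hρ with h | h <;> rw [hab8, h] at h1 <;> omega
  have hac : (a * c) % 8 = 1 := by
    have h1 := Nat.mul_mod a c 8
    rcases hρ with h | h <;> rw [hac8, h] at h1 <;> omega
  have hbc : (b * c) % 8 = 1 := by
    have h1 := Nat.mul_mod b c 8
    rcases hρ with h | h <;> rw [hab8, hac8, h] at h1 <;> omega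
  have habc : (a * b * c) % 8 = a % 8 := by rw [Nat.mul_mod, hab, hac8, one_mul, Nat.mod_mod]
  rcases SixPQ.dvd_or_two_mul_dvd_of_dvd_two_mul hd' with h | ⟨d', rfl, h⟩
  · rcases (dvd_mul_three_iff ha hb hc).mp h with rfl | rfl | rfl | rfl | rfl | rfl | rfl | rfl <;> omega
  · rcases (dvd_mul_three_iff ha hb hc).mp h with rfl | rfl | rfl | rfl | rfl | rfl | rfl | rfl
    · omega
    · exact ⟨by omega, fun _ => Or.inl rfl⟩
    · exact ⟨by omega, fun _ => Or.inr (Or.inl rfl)⟩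
    · exact ⟨by omega, fun _ => Or.inr (Or.inr (Or.inl rfl))⟩
    · omega
    · omega
    · omega
    · exact ⟨by omega, fun _ => Or.inr (Or.inr (Or.inr (by ring)))⟩

/-! ## §3 The pair `φ_aφ_b` is trivial on `L_n(i)` -/

/-- **The Frobenius pair `φ_aφ_b` of `n = 2abc` is trivial on `L_n(i)`** when `a ≡ b ≡ c (mod 8)`, `a ≡ 3 (mod 4)`, `(−c/a) = (−2/a)` and
`(−c/b) = (−2/b)`: both factors negate `i`; their signs on `√−2` and on `√−c` agree; with `t = (−a/b)` one has `(−b/a) = −t` (reciprocity for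
`a ≡ b ≡ 3 (mod 4)`) and, tracking signs through `√−(2c)`, `√−(2ca)` and `√−n`, `φ_b(√−b) = −t·√−b`, so the product fixes `√−b`; the own radical `√−a`
comes from `√−n`. [cite: TianYuanZhang2017, §3.1 (p0011 L60–L66), Prop. 3.2 (2)] [cite: Cox2013, §1 (1.13)–(1.15), §5.C (5.22)] -/
theorem trivialOnL_pair_three_mod_four (hsq : Squarefree n) {a b c : ℕ} (ha : a.Prime) (hb : b.Prime) (hc : c.Prime) (hn : n = 2 * a * b * c)
    (ha4 : a % 4 = 3) (hab8 : b % 8 = a % 8) (hac8 : c % 8 = a % 8)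
    (hca : jacobiSym (-(c : ℤ)) a = jacobiSym (-2) a) (hcb : jacobiSym (-(c : ℤ)) b = jacobiSym (-2) b)
    {φ₁ φ₂ : D.H ≃ₐ[ℚ] D.H}
    (h₁K : φ₁ (D.sqrtNeg n) = D.sqrtNeg n) (h₁i : φ₁ D.im = (jacobiSym (-1) a) • D.im)
    (h₁r : ∀ r : ℕ, r.Prime → r ∣ n → r ≠ a → φ₁ (D.sqrtNeg r) = (jacobiSym (-(r : ℤ)) a) • D.sqrtNeg r)
    (h₂K : φ₂ (D.sqrtNeg n) = D.sqrtNeg n) (h₂i : φ₂ D.im = (jacobiSym (-1) b) • D.im)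
    (h₂r : ∀ r : ℕ, r.Prime → r ∣ n → r ≠ b → φ₂ (D.sqrtNeg r) = (jacobiSym (-(r : ℤ)) b) • D.sqrtNeg r) :
    D.TrivialOnL n (φ₁ * φ₂) := by
  have hn0 : n ≠ 0 := hsq.ne_zero
  have hm : ∀ {d : ℕ}, d ∣ n → d ∈ n.divisors := fun hd => Nat.mem_divisors.mpr ⟨hd, hn0⟩
  have ha2 : a ≠ 2 := by omega
  have hb2 : b ≠ 2 := by omega
  have hc2 : c ≠ 2 := by omega
  have hb4 : b % 4 = 3 := by omega
  have hab : a ≠ b := by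
    rintro rfl; exact ha.one_lt.ne' (Nat.isUnit_iff.mp (hsq a ⟨2 * c, by rw [hn]; ring⟩))
  have hac : a ≠ c := by
    rintro rfl; exact ha.one_lt.ne' (Nat.isUnit_iff.mp (hsq a ⟨2 * b, by rw [hn]; ring⟩))
  have hbc : b ≠ c := by
    rintro rfl; exact hb.one_lt.ne' (Nat.isUnit_iff.mp (hsq b ⟨2 * a, by rw [hn]; ring⟩))
  have hao : Odd a := ha.odd_of_ne_two ha2
  have hbo : Odd b := hb.odd_of_ne_two hb2
  -- divisibility bookkeeping
  have d2 : 2 ∣ n := ⟨a * b * c, by rw [hn]; ring⟩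
  have da : a ∣ n := ⟨2 * b * c, by rw [hn]; ring⟩
  have db : b ∣ n := ⟨2 * a * c, by rw [hn]; ring⟩
  have dc : c ∣ n := ⟨2 * a * b, by rw [hn]; ring⟩
  have d2c : 2 * c ∣ n := ⟨a * b, by rw [hn]; ring⟩
  have d2ca : 2 * c * a ∣ n := ⟨b, by rw [hn]; ring⟩
  have hn' : 2 * c * a * b ∈ n.divisors := by rw [show 2 * c * a * b = n by rw [hn]; ring]; exact Nat.mem_divisors_self n hn0
  -- Legendre/Jacobi values
  have vᵢa : jacobiSym (-1) a = -1 := by rw [jacobiSym.at_neg_one hao, ZMod.χ₄_nat_three_mod_four ha4]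
  have vᵢb : jacobiSym (-1) b = -1 := by rw [jacobiSym.at_neg_one hbo, ZMod.χ₄_nat_three_mod_four hb4]
  have hχ : ∀ m : ℕ, Odd m → jacobiSym (-2) m = if m % 8 = 1 ∨ m % 8 = 3 then 1 else -1 := fun m hmo => by
    rw [jacobiSym.at_neg_two hmo, ZMod.χ₈'_nat_eq_if_mod_eight, if_neg (by rw [Nat.odd_iff] at hmo; omega)]
  have hv : jacobiSym (-2) b = jacobiSym (-2) a := by rw [hχ b hbo, hχ a hao, hab8]
  have hv1 : jacobiSym (-2) a = 1 ∨ jacobiSym (-2) a = -1 := by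
    rw [hχ a hao]
    split_ifs <;> simp
  have hvv : jacobiSym (-2) a * jacobiSym (-2) a = 1 := by rcases hv1 with h | h <;> rw [h] <;> norm_num
  have ht1' : jacobiSym a b = 1 ∨ jacobiSym a b = -1 :=
    jacobiSym.eq_one_or_neg_one (by rw [Int.gcd_natCast_natCast]; exact (Nat.coprime_primes ha hb).mpr hab)
  have ht : jacobiSym (-(a : ℤ)) b = -jacobiSym a b := by
    rw [neg_eq_neg_one_mul, jacobiSym.mul_left, vᵢb, neg_one_mul]
  have ht1 : jacobiSym (-(a : ℤ)) b = 1 ∨ jacobiSym (-(a : ℤ)) b = -1 := by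
    rw [ht]; rcases ht1' with h | h <;> rw [h] <;> norm_num
  have htt : jacobiSym (-(a : ℤ)) b * jacobiSym (-(a : ℤ)) b = 1 := by rcases ht1 with h | h <;> rw [h] <;> norm_num
  have ht' : jacobiSym (-(b : ℤ)) a = -jacobiSym (-(a : ℤ)) b := by
    rw [ht, neg_neg, neg_eq_neg_one_mul, jacobiSym.mul_left, vᵢa, neg_one_mul, jacobiSym.quadratic_reciprocity_three_mod_four hb4 ha4,
      neg_neg]
  -- actions of `φ₁ = φ_a`
  have a1i : φ₁ D.im = (-1 : ℤ) • D.im := by rw [h₁i, vᵢa]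
  have a12 : φ₁ (D.sqrtNeg 2) = (jacobiSym (-2) a) • D.sqrtNeg 2 := by
    rw [h₁r 2 Nat.prime_two d2 ha2.symm, show (-((2 : ℕ) : ℤ)) = -2 by norm_num]
  have a1c : φ₁ (D.sqrtNeg c) = (jacobiSym (-2) a) • D.sqrtNeg c := by rw [h₁r c hc dc hac.symm, hca]
  have a1b : φ₁ (D.sqrtNeg b) = (-jacobiSym (-(a : ℤ)) b) • D.sqrtNeg b := by rw [h₁r b hb db hab.symm, ht']
  -- actions of `φ₂ = φ_b`, with the signs tracked down to `√−b`
  have a2i : φ₂ D.im = (-1 : ℤ) • D.im := by rw [h₂i, vᵢb]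
  have a22 : φ₂ (D.sqrtNeg 2) = (jacobiSym (-2) a) • D.sqrtNeg 2 := by
    rw [h₂r 2 Nat.prime_two d2 hb2.symm, show (-((2 : ℕ) : ℤ)) = -2 by norm_num, hv]
  have a2c : φ₂ (D.sqrtNeg c) = (jacobiSym (-2) a) • D.sqrtNeg c := by rw [h₂r c hc dc hbc.symm, hcb, hv]
  have a2a : φ₂ (D.sqrtNeg a) = (jacobiSym (-(a : ℤ)) b) • D.sqrtNeg a := h₂r a ha da hab
  have a2_2c : φ₂ (D.sqrtNeg (2 * c)) = (-1 : ℤ) • D.sqrtNeg (2 * c) := by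
    have h := apply_sqrtNeg_mul_smul D (hm d2) (hm dc) (hm d2c) (Or.inr rfl) a2i a22 a2c
    rwa [mul_assoc, hvv, mul_one] at h
  have a2_2ca : φ₂ (D.sqrtNeg (2 * c * a)) = (jacobiSym (-(a : ℤ)) b) • D.sqrtNeg (2 * c * a) := by
    have h := apply_sqrtNeg_mul_smul D (hm d2c) (hm da) (hm d2ca) (Or.inr rfl) a2i a2_2c a2a
    rwa [show (-1 : ℤ) * -1 * jacobiSym (-(a : ℤ)) b = jacobiSym (-(a : ℤ)) b by ring] at h
  have h₂K' : φ₂ (D.sqrtNeg (2 * c * a * b)) = (1 : ℤ) • D.sqrtNeg (2 * c * a * b) := by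
    rw [one_zsmul, show 2 * c * a * b = n by rw [hn]; ring]; exact h₂K
  have a2b : φ₂ (D.sqrtNeg b) = (-jacobiSym (-(a : ℤ)) b) • D.sqrtNeg b := by
    have h := apply_sqrtNeg_smul_of_mul D (hm d2ca) (hm db) hn' ht1 a2i a2_2ca h₂K'
    rwa [show (-1 : ℤ) * jacobiSym (-(a : ℤ)) b * 1 = -jacobiSym (-(a : ℤ)) b by ring] at h
  -- the product fixes `i, √−2, √−b, √−c, √−n`
  have ei : (φ₁ * φ₂) D.im = D.im := by
    rw [AlgEquiv.mul_apply, a2i, map_zsmul, a1i, smul_smul]; norm_num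
  have e2 : (φ₁ * φ₂) (D.sqrtNeg 2) = D.sqrtNeg 2 := by
    rw [AlgEquiv.mul_apply, a22, map_zsmul, a12, smul_smul, hvv, one_zsmul]
  have ec : (φ₁ * φ₂) (D.sqrtNeg c) = D.sqrtNeg c := by
    rw [AlgEquiv.mul_apply, a2c, map_zsmul, a1c, smul_smul, hvv, one_zsmul]
  have eb : (φ₁ * φ₂) (D.sqrtNeg b) = D.sqrtNeg b := by
    rw [AlgEquiv.mul_apply, a2b, map_zsmul, a1b, smul_smul, neg_mul_neg, htt, one_zsmul]
  have eK : (φ₁ * φ₂) (D.sqrtNeg n) = D.sqrtNeg n := by rw [AlgEquiv.mul_apply, h₂K, h₁K]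
  refine TwoRPQFive.trivialOnL_of_fix_primes_ne D hsq dvd_rfl ha da ei eK fun p hp hpn hne => ?_
  rcases TwoRPQFive.prime_dvd_two_rpq ha hb hc hp (by rw [← hn]; exact hpn) with rfl | rfl | rfl | rfl
  · exact e2
  · exact absurd rfl hne
  · exact eb
  · exact ec

/-! ## §4 The cell theorem for `n = 2abc` -/

/-- **THE LOWER HALF OF C⁺ ON THE CELL `n = 2abc`** (`a ≡ b ≡ c (mod 8)`, `a ≡ 3 (mod 4)`, `(−c/a) = (−2/a)`, `(−c/b) = (−2/b)`), display shape over
`D.Printed ∧ D.CMPointRingClassFrobeniusValuePrinted`: the pair witness `φ_aφ_b` on the top block, the blocks `2a, 2b, 2c` of the free shape, no block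
`≡ 5`; then the coefficient-aware silence and the even door.
[cite: TianYuanZhang2017, Thm. 1.1, Thm. 3.5, Lemma 3.18, §3.1, Prop. 3.2 (2), Thm. 3.6 (2), proof of Lemma 3.21] [cite: Cox2013, §5.C Cor. 5.25, §9.A] [cite: Darmon2004, Thm. 3.22] -/
theorem two_dvd_scriptL_two_abc_of_valuePrinted (hGZK : rank_eq_analyticRank_of_analyticRank_le_one)
    (hsq : Squarefree n) {a b c : ℕ} (ha : a.Prime) (hb : b.Prime) (hc : c.Prime) (hn : n = 2 * a * b * c) (ha4 : a % 4 = 3)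
    (hab8 : b % 8 = a % 8) (hac8 : c % 8 = a % 8) (hca : jacobiSym (-(c : ℤ)) a = jacobiSym (-2) a)
    (hcb : jacobiSym (-(c : ℤ)) b = jacobiSym (-2) b)
    (hra : haveI := isElliptic_congruentNumberCurve hsq.ne_zero; (congruentNumberCurve n).analyticRank = 1)
    (D : GenusPointData n) (hPr : D.Printed) (hV : D.CMPointRingClassFrobeniusValuePrinted)
    {x y : ℚ} (hxy : (congruentNumberCurve n).toAffine.Nonsingular x y)
    (hgen : haveI := isElliptic_congruentNumberCurve hsq.ne_zero;
      ∀ P, ∃ k : ℤ, IsOfFinAddOrder (P - k • (Point.some x y hxy : (congruentNumberCurve n).toAffine.Point)))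
    (hx : ¬ ∃ r : ℚ, x = r ^ 2 ∨ x = -r ^ 2 ∨ x = n * r ^ 2 ∨ x = -(n * r ^ 2))
    (hx2 : ¬ ∃ r : ℚ, x = 2 * r ^ 2 ∨ x = -(2 * r ^ 2) ∨ x = 2 * n * r ^ 2 ∨ x = -(2 * n * r ^ 2)) :
    ∀ L : ℤ, IsScriptL n L → (2 : ℤ) ∣ L := by
  have hn0 : n ≠ 0 := hsq.ne_zero
  have hnn : n ∈ n.divisors := Nat.mem_divisors_self n hn0
  have ha2 : a ≠ 2 := by omega
  have hb2 : b ≠ 2 := by omega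
  have hab : a ≠ b := by
    rintro rfl; exact ha.one_lt.ne' (Nat.isUnit_iff.mp (hsq a ⟨2 * c, by rw [hn]; ring⟩))
  have hbc8 : (b * c) % 8 = 1 := by
    have h1 := Nat.mul_mod b c 8
    rcases (by omega : a % 8 = 3 ∨ a % 8 = 7) with h | h <;> rw [hab8, hac8, h] at h1 <;> omega
  have h6 : n % 8 = 6 := by
    rw [hn, show 2 * a * b * c = (2 * a) * (b * c) by ring, Nat.mul_mod, hbc8, Nat.mul_mod 2 a]; omega
  have hdvdn : ∀ {d : ℕ}, d ∈ n.divisors → d ∣ 2 * a * b * c := fun hd => hn ▸ Nat.dvd_of_mem_divisors hd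
  obtain ⟨hLs, -, hrec, -, h35, -, -, -, h318, -, -⟩ := hPr
  obtain ⟨z, Φ, ΓH, ΓH', σ, θ, cc, ρ₂, ρ₄, hcc, hbl⟩ := hV
  -- the top witness: the pair `φ_a φ_b`
  obtain ⟨φ₁, φ₂, ⟨h₁K, -, h₁i, h₁r⟩, ⟨h₂K, -, h₂i, h₂r⟩, hee, heH⟩ :=
    exists_pairWitness_of_clauses D hsq hbl hnn h6 ha hb hab (hn ▸ ⟨2 * b * c, by ring⟩) (hn ▸ ⟨2 * a * c, by ring⟩) ha2 hb2
  have heL : D.TrivialOnL n (φ₁ * φ₂) :=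
    trivialOnL_pair_three_mod_four D hsq ha hb hc hn ha4 hab8 hac8 hca hcb h₁K h₁i h₁r h₂K h₂i h₂r
  refine two_dvd_scriptL_of_coefficients_even_of_x_not_mem D hGZK hsq h6 hra hrec h35 hLs h318 z Φ ΓH ΓH' σ cc hcc
    (fun d hd => ⟨(hbl d hd).1, (hbl d hd).2.2.1⟩) ⟨φ₁ * φ₂, heL, hee, heH⟩ (fun d hd hd6 hdn => ?_) (fun d hd hd5 => ?_) hxy hgen hx hx2
  · -- proper even blocks `2a`, `2b`, `2c`: the free shape
    rcases (divisors_two_abc ha hb hc ha4 hab8 hac8 (hdvdn hd)).2 hd6 with rfl | rfl | rfl | rfl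
    · exact Or.inl ⟨a, ha, rfl⟩
    · exact Or.inl ⟨b, hb, rfl⟩
    · exact Or.inl ⟨c, hc, rfl⟩
    · exact absurd hn.symm hdn
  · exact absurd hd5 (divisors_two_abc ha hb hc ha4 hab8 hac8 (hdvdn hd)).1

/-- **THE LOWER HALF ON THE CELL `n = 2abc`, THREE PRIMES `≡ 3 (mod 4)`, FROM THE NAMED FACTS** (`OfFacts` shape, by-name closable):
`(tyz_cmPointRingClassFrobeniusValueData ∧ thm11_parity_of_scriptL ∧ GZK)` implies — for primes `a ≡ b ≡ c (mod 8)` with `a ≡ 3 (mod 4)`,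
`(−c/a) = (−2/a)` and `(−c/b) = (−2/b)` (i.e. `(c/a) = (c/b) = −1` when `a ≡ 3 (mod 8)`, `(c/a) = (c/b) = +1` when `a ≡ 7 (mod 8)`), `n = 2abc` square-free,
`ord_{s=1} L(E_n, s) = 1`, and a generator `R = (x, y)` of `E_n(ℚ)` modulo torsion with `x ∉ {±1, ±2, ±n, ±2n}·ℚ^{×2}` — `2 ∣ L` whenever `𝓛(n)² = L²`.
(`thm11_parity_of_scriptL` is carried for uniformity with the sibling cells; this cell does not use it.)
[cite: TianYuanZhang2017, Thm. 1.1, §1, §3, Prop. 3.2 (2)] [cite: Cox2013, §5.C Cor. 5.25, §9.A] [cite: HeathBrown1994SelmerCongruentII, §1] [cite: Darmon2004, Thm. 3.22] -/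
theorem two_dvd_scriptL_two_abc_of_facts :
    (tyz_cmPointRingClassFrobeniusValueData ∧ thm11_parity_of_scriptL ∧ rank_eq_analyticRank_of_analyticRank_le_one) →
      ∀ n a b c : ℕ, (hsq : Squarefree n) → a.Prime → b.Prime → c.Prime → n = 2 * a * b * c → a % 4 = 3 → b % 8 = a % 8 → c % 8 = a % 8 →
        jacobiSym (-(c : ℤ)) a = jacobiSym (-2) a → jacobiSym (-(c : ℤ)) b = jacobiSym (-2) b →
        (haveI := isElliptic_congruentNumberCurve hsq.ne_zero; (congruentNumberCurve n).analyticRank = 1) →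
        ∀ (x y : ℚ) (hxy : (congruentNumberCurve n).toAffine.Nonsingular x y),
          (haveI := isElliptic_congruentNumberCurve hsq.ne_zero;
            ∀ P, ∃ k : ℤ, IsOfFinAddOrder (P - k • (Point.some x y hxy : (congruentNumberCurve n).toAffine.Point))) →
          (¬ ∃ r : ℚ, x = r ^ 2 ∨ x = -r ^ 2 ∨ x = n * r ^ 2 ∨ x = -(n * r ^ 2)) →
          (¬ ∃ r : ℚ, x = 2 * r ^ 2 ∨ x = -(2 * r ^ 2) ∨ x = 2 * n * r ^ 2 ∨ x = -(2 * n * r ^ 2)) →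
            ∀ L : ℤ, IsScriptL n L → (2 : ℤ) ∣ L := by
  intro h n a b c hsq ha hb hc hn ha4 hab8 hac8 hca hcb hra x y hxy hgen hx hx2
  have hbc8 : (b * c) % 8 = 1 := by
    have h1 := Nat.mul_mod b c 8
    rcases (by omega : a % 8 = 3 ∨ a % 8 = 7) with h | h <;> rw [hab8, hac8, h] at h1 <;> omega
  have h6 : n % 8 = 6 := by
    rw [hn, show 2 * a * b * c = (2 * a) * (b * c) by ring, Nat.mul_mod, hbc8, Nat.mul_mod 2 a]; omega
  obtain ⟨D, hPr, hV⟩ := h.1 n hsq (Or.inr (Or.inl h6))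
  exact two_dvd_scriptL_two_abc_of_valuePrinted h.2.2 hsq ha hb hc hn ha4 hab8 hac8 hca hcb hra D hPr hV hxy hgen hx hx2

end Summit.BirchSwinnertonDyer.PrintCf2.TwoABC

end
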